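import Mathlib
import HarnessLib
import Summits.HubbardSuperconductivity.HubbardSuperconductivity.Theorems.KLProgrammeKLRegimeEngineFrameShiftResponseDoorCTMismatch
import Summits.HubbardSuperconductivity.HubbardSuperconductivity.Theorems.KLProgrammeKLRegimeSplitSlotsV17F
import Summits.HubbardSuperconductivity.HubbardSuperconductivity.Theorems.KLProgrammeKLRegimeFrameShellCount
import Summits.HubbardSuperconductivity.HubbardSuperconductivity.Theorems.KLProgrammeKLRegimeSplitFrameDist
import Summits.HubbardSuperconductivity.HubbardSuperconductivity.Theorems.KLProgrammeKLRegimeSplitGlue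
import Summits.HubbardSuperconductivity.HubbardSuperconductivity.Theorems.KLProgrammeKLRegimeEngineFrameShiftResponseDoorCTMismatchFlow
import Summits.HubbardSuperconductivity.HubbardSuperconductivity.Theorems.KLProgrammeKLRegimeEngineFrameShiftResponseDoorCTMismatchPure

/-!
# K3 gen-8-FLOW (stmt 20437, stub (C), located «(B)-MAIN-UNPRIMED», cure «(B)-MAIN-PURE»): the corrected (B) door AT THE FLOW FRAMES — PURE tower moments (cell gate-hubbard-kl, seat p2 g22)

Twin of `…KLProgrammeKLRegimeEngineFrameShiftResponseDoorCTMismatchFlow.norm_iteratedFDeriv_klLocSelfEnergyRe_flowFrame_sub_le` with the ONE tower input `N` (pinned moments of `𝔉⁻¹` of the FOUR-leg kernel at the loop strings) asked in the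
PURE weight `(|x̃₀|+|x̃₁|)ʲ` — zero at the local vertex for `j ≥ 1` — instead of `(1+|x̃₀|+|x̃₁|)ʲ`; every other hypothesis (two-leg rows keep the
submultiplicative weight `(1+|x̃₀|+|x̃₁|)^·`), the conclusion and the proof are VERBATIM, the proof calling the `_pure` twin of the predecessor door.
WHY (KL STATUS 2026-08-28, p2 g22 «(B)-MAIN-UNPRIMED»): with the `(1+…)ʲ` weight the MAIN group of the general-step (B) door is `O(U²)` at every order
(the k-independent tadpole response of the bare vertex is charged in full) and its derivative rows cannot be booked against the unprimed curve-jet table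
`klC4aJetC2`; with the pure weight the natural law of `N_j` is `O(U²)·(Λ_m⁻¹)ʲ` for `j ≥ 1`, so those rows are `O(U³)`.

* **`norm_iteratedFDeriv_klLocSelfEnergyRe_flowFrame_sub_le_pure`**.

Composition only; no definitions; nothing about the sizes is asserted; nothing asserts superconductivity.  References: BGM 2006 §2.3 (2.21)–(2.24), §3 (3.3)
[cite: BenfattoGiulianiMastropietro2006]; Salmhofer 1999 §4.2.5; FST 1996 §1.
-/

noncomputable section

namespace Summit.HubbardSuperconductivity.HubbardSuperconductivity.Theorems.EngineV8

set_option linter.dupNamespace false -- summit = problem name (single-conjunct summit), D-0017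

open Finset Literature.MathematicalPhysics.QuantumLattice Literature.Probability.LatticeModels GrassmannAlgebra
open Summit.HubbardSuperconductivity.HubbardSuperconductivity.Theorems.KLRegimeSplit
open Summit.HubbardSuperconductivity.HubbardSuperconductivity.Theorems.TwoVolumeDefect
open Summit.HubbardSuperconductivity.HubbardSuperconductivity.Theorems.KLProgrammeLegKernels

variable {L M : ℕ} [NeZero L] [NeZero M]

section Flow

variable {β : ℝ} (hβ : 0 < β) (U μ : ℝ) (m : ℕ)
include hβ

/-- **THE CORRECTED (B) DOOR AT THE FLOW FRAMES `K_m → K_{m+1}`** (mismatch-resummed representation, jet form, shell counts discharged).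
[cite: BenfattoGiulianiMastropietro2006, §2.3 (2.21)–(2.24)] -/
theorem norm_iteratedFDeriv_klLocSelfEnergyRe_flowFrame_sub_le_pure
    {R : RenConsts} {Nf₁ Nf₂ : ℕ} (hOK₁ : FrameOK R U Nf₁ μ (klFlowFrameU L M β U μ m)) (hOK₂ : FrameOK R U Nf₂ μ (klFlowFrameU L M β U μ (m + 1)))
    {B₁ : ℝ} (hB0 : 0 ≤ B₁) (hB : ∀ y, |deriv salmhoferCutoff y| ≤ B₁)
    {fd : ℝ} (hfdist : frameDist (klFlowFrameU L M β U μ (m + 1)) (klFlowFrameU L M β U μ m) ≤ fd) (hfd : fd ≤ klScale klE0 m / 4)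
    (hZ₂ : IsUnit (effPartitionFn ℂ (normalCovariance L M (uvSymbolCT L M β μ (klFlowFrameU L M β U μ (m + 1)) (klScale klE0 m)))
      (hubbardInteraction L M β U + counterQuadratic L M β (klFlowFrameU L M β U μ (m + 1)))))
    (hZ : ∀ t ∈ Set.Icc (0 : ℝ) 1, effPartitionFn ℂ
      (normalCovariance L M (uvSymbolCT L M β μ (klFlowFrameU L M β U μ m) (klScale klE0 m)) + ((t : ℂ)) •
        (normalCovariance L M (fun ks => uvSymbolCT L M β μ (klFlowFrameU L M β U μ (m + 1)) (klScale klE0 m) ks /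
            (1 + uvSymbolCT L M β μ (klFlowFrameU L M β U μ (m + 1)) (klScale klE0 m) ks * (((fsub (klFlowFrameU L M β U μ (m + 1)) (klFlowFrameU L M β U μ m)).eval (latticeMomentum L ks.1.2) / (β * (L : ℝ) ^ 2) : ℝ) : ℂ))) -
          normalCovariance L M (uvSymbolCT L M β μ (klFlowFrameU L M β U μ m) (klScale klE0 m))))
      (hubbardInteraction L M β U + counterQuadratic L M β (klFlowFrameU L M β U μ m)) ≠ 0)
    (j : ℕ) (q : Momentum) {N A A' AJ : ℝ} (hN0 : 0 ≤ N) (hA0 : 0 ≤ A) (hA0' : 0 ≤ A')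
    (hN : ∀ t ∈ Set.Icc (0 : ℝ) 1, ∀ i ∈ ({omega0 M, (omega0 M).rev} : Finset (MatsubaraIdx M)), ∀ σ : Fin 2, ∀ Al : HubbardFieldIdx L M,
      |matsubaraFreq β M Al.1.1.1| < klScale klE0 m →
      (|nambuXiCT L μ (klFlowFrameU L M β U μ m) Al.1.1.2| < klScale klE0 m ∨ |nambuXiCT L μ (klFlowFrameU L M β U μ (m + 1)) Al.1.1.2| < klScale klE0 m) →
      ∑ x : TorusSite 2 L, (((x 0).valMinAbs.natAbs : ℝ) + ((x 1).valMinAbs.natAbs : ℝ)) ^ j * ‖torusFourierInv (fun kv : TorusSite 2 L =>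
        kernel ℂ (effAction ℂ (normalCovariance L M (uvSymbolCT L M β μ (klFlowFrameU L M β U μ m) (klScale klE0 m)) + ((t : ℂ)) •
          (normalCovariance L M (fun ks => uvSymbolCT L M β μ (klFlowFrameU L M β U μ (m + 1)) (klScale klE0 m) ks /
              (1 + uvSymbolCT L M β μ (klFlowFrameU L M β U μ (m + 1)) (klScale klE0 m) ks * (((fsub (klFlowFrameU L M β U μ (m + 1)) (klFlowFrameU L M β U μ m)).eval (latticeMomentum L ks.1.2) / (β * (L : ℝ) ^ 2) : ℝ) : ℂ))) -
            normalCovariance L M (uvSymbolCT L M β μ (klFlowFrameU L M β U μ m) (klScale klE0 m))))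
          (hubbardInteraction L M β U + counterQuadratic L M β (klFlowFrameU L M β U μ m))) 4
          (Fin.snoc (Fin.snoc ![((((i, kv), σ), 0) : HubbardFieldIdx L M), (((i, kv), σ), 1)] (Al.1, 1 - Al.2) : Fin 3 → HubbardFieldIdx L M) Al)) x‖ ≤ N)
    (hT : ∀ t ∈ Set.Icc (0 : ℝ) 1,
      ‖iteratedFDeriv ℝ j (evalM (symInterp L (fun kv : TorusSite 2 L => ((∑ σ : Fin 2,
        (selfEnergy L M β (grassmannDerivPairing ℂ
            (normalCovariance L M (fun ks => uvSymbolCT L M β μ (klFlowFrameU L M β U μ (m + 1)) (klScale klE0 m) ks /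
                (1 + uvSymbolCT L M β μ (klFlowFrameU L M β U μ (m + 1)) (klScale klE0 m) ks * (((fsub (klFlowFrameU L M β U μ (m + 1)) (klFlowFrameU L M β U μ m)).eval (latticeMomentum L ks.1.2) / (β * (L : ℝ) ^ 2) : ℝ) : ℂ))) -
              normalCovariance L M (uvSymbolCT L M β μ (klFlowFrameU L M β U μ m) (klScale klE0 m)))
            (effAction ℂ (normalCovariance L M (uvSymbolCT L M β μ (klFlowFrameU L M β U μ m) (klScale klE0 m)) + ((t : ℂ)) •
              (normalCovariance L M (fun ks => uvSymbolCT L M β μ (klFlowFrameU L M β U μ (m + 1)) (klScale klE0 m) ks /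
                  (1 + uvSymbolCT L M β μ (klFlowFrameU L M β U μ (m + 1)) (klScale klE0 m) ks * (((fsub (klFlowFrameU L M β U μ (m + 1)) (klFlowFrameU L M β U μ m)).eval (latticeMomentum L ks.1.2) / (β * (L : ℝ) ^ 2) : ℝ) : ℂ))) -
                normalCovariance L M (uvSymbolCT L M β μ (klFlowFrameU L M β U μ m) (klScale klE0 m))))
              (hubbardInteraction L M β U + counterQuadratic L M β (klFlowFrameU L M β U μ m)))
            (effAction ℂ (normalCovariance L M (uvSymbolCT L M β μ (klFlowFrameU L M β U μ m) (klScale klE0 m)) + ((t : ℂ)) •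
              (normalCovariance L M (fun ks => uvSymbolCT L M β μ (klFlowFrameU L M β U μ (m + 1)) (klScale klE0 m) ks /
                  (1 + uvSymbolCT L M β μ (klFlowFrameU L M β U μ (m + 1)) (klScale klE0 m) ks * (((fsub (klFlowFrameU L M β U μ (m + 1)) (klFlowFrameU L M β U μ m)).eval (latticeMomentum L ks.1.2) / (β * (L : ℝ) ^ 2) : ℝ) : ℂ))) -
                normalCovariance L M (uvSymbolCT L M β μ (klFlowFrameU L M β U μ m) (klScale klE0 m))))
              (hubbardInteraction L M β U + counterQuadratic L M β (klFlowFrameU L M β U μ m)))) (omega0 M, kv) σ +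
          selfEnergy L M β (grassmannDerivPairing ℂ
            (normalCovariance L M (fun ks => uvSymbolCT L M β μ (klFlowFrameU L M β U μ (m + 1)) (klScale klE0 m) ks /
                (1 + uvSymbolCT L M β μ (klFlowFrameU L M β U μ (m + 1)) (klScale klE0 m) ks * (((fsub (klFlowFrameU L M β U μ (m + 1)) (klFlowFrameU L M β U μ m)).eval (latticeMomentum L ks.1.2) / (β * (L : ℝ) ^ 2) : ℝ) : ℂ))) -
              normalCovariance L M (uvSymbolCT L M β μ (klFlowFrameU L M β U μ m) (klScale klE0 m)))
            (effAction ℂ (normalCovariance L M (uvSymbolCT L M β μ (klFlowFrameU L M β U μ m) (klScale klE0 m)) + ((t : ℂ)) •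
              (normalCovariance L M (fun ks => uvSymbolCT L M β μ (klFlowFrameU L M β U μ (m + 1)) (klScale klE0 m) ks /
                  (1 + uvSymbolCT L M β μ (klFlowFrameU L M β U μ (m + 1)) (klScale klE0 m) ks * (((fsub (klFlowFrameU L M β U μ (m + 1)) (klFlowFrameU L M β U μ m)).eval (latticeMomentum L ks.1.2) / (β * (L : ℝ) ^ 2) : ℝ) : ℂ))) -
                normalCovariance L M (uvSymbolCT L M β μ (klFlowFrameU L M β U μ m) (klScale klE0 m))))
              (hubbardInteraction L M β U + counterQuadratic L M β (klFlowFrameU L M β U μ m)))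
            (effAction ℂ (normalCovariance L M (uvSymbolCT L M β μ (klFlowFrameU L M β U μ m) (klScale klE0 m)) + ((t : ℂ)) •
              (normalCovariance L M (fun ks => uvSymbolCT L M β μ (klFlowFrameU L M β U μ (m + 1)) (klScale klE0 m) ks /
                  (1 + uvSymbolCT L M β μ (klFlowFrameU L M β U μ (m + 1)) (klScale klE0 m) ks * (((fsub (klFlowFrameU L M β U μ (m + 1)) (klFlowFrameU L M β U μ m)).eval (latticeMomentum L ks.1.2) / (β * (L : ℝ) ^ 2) : ℝ) : ℂ))) -
                normalCovariance L M (uvSymbolCT L M β μ (klFlowFrameU L M β U μ m) (klScale klE0 m))))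
              (hubbardInteraction L M β U + counterQuadratic L M β (klFlowFrameU L M β U μ m)))) ((omega0 M).rev, kv) σ)) / 4).re))) q‖ ≤ A ∧
      ‖iteratedFDeriv ℝ j (evalM (symInterp L (fun kv : TorusSite 2 L => ((∑ σ : Fin 2,
        (selfEnergy L M β (grassmannDerivPairing ℂ
            (normalCovariance L M (fun ks => uvSymbolCT L M β μ (klFlowFrameU L M β U μ (m + 1)) (klScale klE0 m) ks /
                (1 + uvSymbolCT L M β μ (klFlowFrameU L M β U μ (m + 1)) (klScale klE0 m) ks * (((fsub (klFlowFrameU L M β U μ (m + 1)) (klFlowFrameU L M β U μ m)).eval (latticeMomentum L ks.1.2) / (β * (L : ℝ) ^ 2) : ℝ) : ℂ))) -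
              normalCovariance L M (uvSymbolCT L M β μ (klFlowFrameU L M β U μ m) (klScale klE0 m)))
            (effAction ℂ (normalCovariance L M (uvSymbolCT L M β μ (klFlowFrameU L M β U μ m) (klScale klE0 m)) + ((t : ℂ)) •
              (normalCovariance L M (fun ks => uvSymbolCT L M β μ (klFlowFrameU L M β U μ (m + 1)) (klScale klE0 m) ks /
                  (1 + uvSymbolCT L M β μ (klFlowFrameU L M β U μ (m + 1)) (klScale klE0 m) ks * (((fsub (klFlowFrameU L M β U μ (m + 1)) (klFlowFrameU L M β U μ m)).eval (latticeMomentum L ks.1.2) / (β * (L : ℝ) ^ 2) : ℝ) : ℂ))) -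
                normalCovariance L M (uvSymbolCT L M β μ (klFlowFrameU L M β U μ m) (klScale klE0 m))))
              (hubbardInteraction L M β U + counterQuadratic L M β (klFlowFrameU L M β U μ m)))
            (effAction ℂ (normalCovariance L M (uvSymbolCT L M β μ (klFlowFrameU L M β U μ m) (klScale klE0 m)) + ((t : ℂ)) •
              (normalCovariance L M (fun ks => uvSymbolCT L M β μ (klFlowFrameU L M β U μ (m + 1)) (klScale klE0 m) ks /
                  (1 + uvSymbolCT L M β μ (klFlowFrameU L M β U μ (m + 1)) (klScale klE0 m) ks * (((fsub (klFlowFrameU L M β U μ (m + 1)) (klFlowFrameU L M β U μ m)).eval (latticeMomentum L ks.1.2) / (β * (L : ℝ) ^ 2) : ℝ) : ℂ))) -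
                normalCovariance L M (uvSymbolCT L M β μ (klFlowFrameU L M β U μ m) (klScale klE0 m))))
              (hubbardInteraction L M β U + counterQuadratic L M β (klFlowFrameU L M β U μ m)))) (omega0 M, kv) σ +
          selfEnergy L M β (grassmannDerivPairing ℂ
            (normalCovariance L M (fun ks => uvSymbolCT L M β μ (klFlowFrameU L M β U μ (m + 1)) (klScale klE0 m) ks /
                (1 + uvSymbolCT L M β μ (klFlowFrameU L M β U μ (m + 1)) (klScale klE0 m) ks * (((fsub (klFlowFrameU L M β U μ (m + 1)) (klFlowFrameU L M β U μ m)).eval (latticeMomentum L ks.1.2) / (β * (L : ℝ) ^ 2) : ℝ) : ℂ))) -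
              normalCovariance L M (uvSymbolCT L M β μ (klFlowFrameU L M β U μ m) (klScale klE0 m)))
            (effAction ℂ (normalCovariance L M (uvSymbolCT L M β μ (klFlowFrameU L M β U μ m) (klScale klE0 m)) + ((t : ℂ)) •
              (normalCovariance L M (fun ks => uvSymbolCT L M β μ (klFlowFrameU L M β U μ (m + 1)) (klScale klE0 m) ks /
                  (1 + uvSymbolCT L M β μ (klFlowFrameU L M β U μ (m + 1)) (klScale klE0 m) ks * (((fsub (klFlowFrameU L M β U μ (m + 1)) (klFlowFrameU L M β U μ m)).eval (latticeMomentum L ks.1.2) / (β * (L : ℝ) ^ 2) : ℝ) : ℂ))) -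
                normalCovariance L M (uvSymbolCT L M β μ (klFlowFrameU L M β U μ m) (klScale klE0 m))))
              (hubbardInteraction L M β U + counterQuadratic L M β (klFlowFrameU L M β U μ m)))
            (effAction ℂ (normalCovariance L M (uvSymbolCT L M β μ (klFlowFrameU L M β U μ m) (klScale klE0 m)) + ((t : ℂ)) •
              (normalCovariance L M (fun ks => uvSymbolCT L M β μ (klFlowFrameU L M β U μ (m + 1)) (klScale klE0 m) ks /
                  (1 + uvSymbolCT L M β μ (klFlowFrameU L M β U μ (m + 1)) (klScale klE0 m) ks * (((fsub (klFlowFrameU L M β U μ (m + 1)) (klFlowFrameU L M β U μ m)).eval (latticeMomentum L ks.1.2) / (β * (L : ℝ) ^ 2) : ℝ) : ℂ))) -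
                normalCovariance L M (uvSymbolCT L M β μ (klFlowFrameU L M β U μ m) (klScale klE0 m))))
              (hubbardInteraction L M β U + counterQuadratic L M β (klFlowFrameU L M β U μ m)))) ((omega0 M).rev, kv) σ)) / 4).im))) q‖ ≤ A')
    (hJ : ‖iteratedFDeriv ℝ j (evalM (symInterp L (fun kv : TorusSite 2 L =>
        (∑ σ : Fin 2, ∑ i ∈ ({omega0 M, (omega0 M).rev} : Finset (MatsubaraIdx M)),
          (-(((β * (L : ℝ) ^ 2 : ℝ) : ℂ) * (((fsub (klFlowFrameU L M β U μ (m + 1)) (klFlowFrameU L M β U μ m)).eval (latticeMomentum L kv) / (β * (L : ℝ) ^ 2) : ℝ) : ℂ) ^ 2 *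
              (uvSymbolCT L M β μ (klFlowFrameU L M β U μ (m + 1)) (klScale klE0 m) ((i, kv), σ) /
                (1 + uvSymbolCT L M β μ (klFlowFrameU L M β U μ (m + 1)) (klScale klE0 m) ((i, kv), σ) * (((fsub (klFlowFrameU L M β U μ (m + 1)) (klFlowFrameU L M β U μ m)).eval (latticeMomentum L kv) / (β * (L : ℝ) ^ 2) : ℝ) : ℂ)))) +
            ((1 - (((fsub (klFlowFrameU L M β U μ (m + 1)) (klFlowFrameU L M β U μ m)).eval (latticeMomentum L kv) / (β * (L : ℝ) ^ 2) : ℝ) : ℂ) *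
                (uvSymbolCT L M β μ (klFlowFrameU L M β U μ (m + 1)) (klScale klE0 m) ((i, kv), σ) /
                  (1 + uvSymbolCT L M β μ (klFlowFrameU L M β U μ (m + 1)) (klScale klE0 m) ((i, kv), σ) * (((fsub (klFlowFrameU L M β U μ (m + 1)) (klFlowFrameU L M β U μ m)).eval (latticeMomentum L kv) / (β * (L : ℝ) ^ 2) : ℝ) : ℂ)))) ^ 2 -
                1) *
              selfEnergy L M β (effAction ℂ (normalCovariance L M fun ks =>
                uvSymbolCT L M β μ (klFlowFrameU L M β U μ (m + 1)) (klScale klE0 m) ks /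
                  (1 + uvSymbolCT L M β μ (klFlowFrameU L M β U μ (m + 1)) (klScale klE0 m) ks * (((fsub (klFlowFrameU L M β U μ (m + 1)) (klFlowFrameU L M β U μ m)).eval (latticeMomentum L ks.1.2) / (β * (L : ℝ) ^ 2) : ℝ) : ℂ)))
              (hubbardInteraction L M β U + counterQuadratic L M β (klFlowFrameU L M β U μ m))) (i, kv) σ).re) / 4))) q‖ ≤ AJ) :
    ‖iteratedFDeriv ℝ j (evalM (symInterp L (fun kv : TorusSite 2 L =>
        klLocSelfEnergyRe L M β U μ (klFlowFrameU L M β U μ (m + 1)) m kv - klLocSelfEnergyRe L M β U μ (klFlowFrameU L M β U μ m) m kv - (fsub (klFlowFrameU L M β U μ (m + 1)) (klFlowFrameU L M β U μ m)).eval (latticeMomentum L kv)))) q‖ ≤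
      2 * (2 * (|β| * (L : ℝ) ^ 2) * (12 * (2 * (klScale klE0 m * β / Real.pi + 3) *
        ((1793 * klScale klE0 m * (L : ℝ) ^ 2 + 704 * L) + (1793 * klScale klE0 m * (L : ℝ) ^ 2 + 704 * L)) *
        (β * (L : ℝ) ^ 2 * (200 + 200 * B₁) / klScale klE0 m ^ 2 * fd)) * N)) + (A + A') / 2 + AJ := by
  have hL : (0 : ℝ) < L := by exact_mod_cast NeZero.pos L
  have hΛ : 0 < klScale klE0 m := by unfold klScale; exact mul_pos klE0_pos (by positivity)
  have hΛle : klScale klE0 m ≤ 3 / 80 := by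
    have h1 : klScale klE0 m ≤ klE0 := by
      unfold klScale
      exact mul_le_of_le_one_right klE0_pos.le (inv_le_one_of_one_le₀ (one_le_pow₀ (by norm_num)))
    exact h1.trans (by norm_num [klE0])
  -- pointwise mismatch bound from the frame distance
  have hD : ∀ kv : TorusSite 2 L, |(fsub (klFlowFrameU L M β U μ (m + 1)) (klFlowFrameU L M β U μ m)).eval (latticeMomentum L kv)| ≤ fd :=
    fun kv => by rw [eval_fsub]; exact (abs_eval_sub_le_frameDist _ _ _).trans hfdist
  -- the counts
  set Nω := (Finset.univ.filter fun i : MatsubaraIdx M => |matsubaraFreq β M i| < klScale klE0 m).card with hNω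
  set Nk₁ := (Finset.univ.filter fun kv : TorusSite 2 L => |nambuXiCT L μ (klFlowFrameU L M β U μ m) kv| < klScale klE0 m).card with hNk₁
  set Nk₂ := (Finset.univ.filter fun kv : TorusSite 2 L => |nambuXiCT L μ (klFlowFrameU L M β U μ (m + 1)) kv| < klScale klE0 m).card with hNk₂
  have hω : (Nω : ℝ) ≤ klScale klE0 m * β / Real.pi + 3 :=
    card_filter_matsubaraFreq_le hβ hΛ.le _ fun i hi => ((Finset.mem_filter.1 hi).2).le
  have hk₁ : (Nk₁ : ℝ) ≤ 1793 * klScale klE0 m * (L : ℝ) ^ 2 + 704 * L := card_frameLevel_lt_le hOK₁ hΛ hΛle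
  have hk₂ : (Nk₂ : ℝ) ≤ 1793 * klScale klE0 m * (L : ℝ) ^ 2 + 704 * L := card_frameLevel_lt_le hOK₂ hΛ hΛle
  have hdoor := norm_iteratedFDeriv_klLocSelfEnergyRe_frame_sub_le_pure hβ U μ (klFlowFrameU L M β U μ m) (klFlowFrameU L M β U μ (m + 1)) m
    hB0 hB hΛ hfd hD le_rfl le_rfl le_rfl hZ₂ hZ j q hN0 hA0 hA0' hN hT hJ
  refine hdoor.trans ?_
  have hfd0 : 0 ≤ fd := (frameDist_nonneg _ _).trans hfdist
  gcongr

end Flow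

end Summit.HubbardSuperconductivity.HubbardSuperconductivity.Theorems.EngineV8

end
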